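import Summits.ResolutionOfSingularities.ResolutionOfSingularities.Theorems.PurelyInseparableDim4E2OfCJS
import Summits.ResolutionOfSingularities.ResolutionOfSingularities.Theorems.PurelyInseparableDim4IsolatedChainBaseChange
import HarnessLib

/-!
# F4-I(3,3) from CJS — the transfer row `IsolatedConeTwoChainLocalizes` SPLIT into five sub-rows along ONE
# presentation predicate, and the abstract composition (cell `res-dim4-pi`, WORD #52 (c))

[OURS · counted 0 · AI work weaker than expert review.]  Cell `res-dim4-pi` (D-0157 DOOR 2), seat `res-dim4-p-2`
g2 (file owner), sub-rows assigned by the desk: (N), (E) → res-dim4-p-1 g2; (M), (I), (X) → res-dim4-p-2;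
K → res-dim4-p-9 g2.  NOTHING here proves any sub-row, `NoIsolatedTrap 3 3`, or resolution of singularities in
dimension ≥ 4 / characteristic `p`.

Companion of `…E2OfCJS` (p663256: `noWideTrap_three_of_CJS : KeyTheorem640_char_localized_isolated →
IsolatedConeTwoChainLocalizes → NoWideTrap 3 3`).  The transfer row packages the scheme-level dictionary as ONE
signature; here it is CUT along a single interface so that four of the five pieces are statements of pure
LOCAL ALGEBRA about ONE local ring, and the fifth carries all the construction debt:

* `HypStalk L F` — the local ring `𝒪_{𝔸⁵_L, 0} ⧸ (z³ + F)·𝒪_{𝔸⁵_L, 0}` of the hypersurface `z³ + F = 0` at the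
  origin (tree `AffinePointBlowup.P 4 L`, `ξ 4 L`, `PIDim4.hypSheaf`, `stalkIdeal`);
  `PresentedBy L F S s` — «the local ring of `S` at `s` IS that ring» (`Nonempty (𝒪_{S,s} ≅ HypStalk L F)`).
* (N) `NearRow` — two points presented by `F`, `G` of residual order `3` over the same perfect `L` have the SAME
  Hilbert–Samuel function (a multiplicity-`3` hypersurface point in regular `5`-space; CJS Ch. 2).
* (E) `DirectrixRow` — a point presented by `F` (`ordZero F = 3`, `L` perfect) has `e = ē = ebar F`
  (`Dir(z³ + Φ) ≅ A(Φ)` through `v ↦ ((−Φ(v))^{1/3}, v)`; CJS Def. 2.18/2.21/2.26).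
* (I) `IsolationRow` — a LOCAL scheme presented by `F` with `IsIsolated 3 F` has its closed point isolated in its
  Hilbert–Samuel locus (T-ISO-1: the `3`-fold locus of `z³ + F` projects onto `V(J₃⁺(F))`).
* (X) `SettingRow` — such a local scheme is excellent, of dimension `≤ 5` (`= 4` in truth), satisfies (F1) at
  `char 3`, and its closed point is a permissible centre.
* (M) `ModelRow` — over an ALGEBRAICALLY CLOSED field `K` of characteristic `3` (res-dim4-p-9 K-SPLIT
  ADDENDUM: the base change (L-D0) is ALREADY in the tree — p-14's
  `IsolatedChainBaseChange.noIsolatedTrap_of_forall_isAlgClosed`: F4-I may be checked over algebraically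
  closed fields — so the model row may assume `K` algebraically closed, which is also what typ-3's
  `point_step_package` wants), every E2-violating frame chain `c` has the chain of local schemes / point
  blow-ups / closed points / local-scheme links of the transfer row, every node PRESENTED by the frame's own
  residual polynomial: `(S i, pt i)` by `(c i).F`, `(B i, b i)` by `(c (i+1)).F` (typ-3's
  `PointStepLocal/Chart/Package` INVARIANT is the chart side of this construction).
* **`isolatedConeTwoChainLocalizesAlgClosed_of_rows : ModelRow → NearRow → DirectrixRow → IsolationRow →
  SettingRow → IsolatedConeTwoChainLocalizesAlgClosed`** (the transfer row with `K` algebraically closed — the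
  all-fields row p663256 implies it, `…AlgClosed_of_all`) — the composition, by bookkeeping only; and the
  per-field endgame **`no_isolated_chain_of_no_coneTwo_chain`** (one field: no `e = ē = 2` cone chain ⇒ no
  isolated chain at all, by the tree's order dichotomy, K2(3), `ē ∈ {1,2}` stabilisation and FT(3,3)), whence
  **`noIsolatedTrap_three_three_of_CJS_algClosed : KeyTheorem640_char_localized_isolated →
  IsolatedConeTwoChainLocalizesAlgClosed → NoIsolatedTrap 3 3`** and **`noIsolatedTrap_three_three_of_CJS_rows`**.

All five rows are OURS, parameterless `Prop`s, deliberately untagged (the gate must not relocate them to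
`Literature/`; precedent W4.2 `MovingLineageLocalizesM` / `LocalChainPrintedFacts`), NOT statements of
[CJS 2020], not asserted.  bears_on: LADDER-RESOLUTION:D157-DOOR2 (res-dim4-pi · F4-I(3,3) · CJS dictionary).
Supports stmt-ResolutionOfSingularities-16155 (helper).
-/

set_option linter.dupNamespace false -- mandated namespace of this single-conjunct summit

noncomputable section

open CategoryTheory AlgebraicGeometry TopologicalSpace IsLocalRing
open Literature.AlgebraicGeometry.Resolution Literature.RingTheory.HilbertSamuel
open Literature.AlgebraicGeometry.Resolution.Hauser2010
open Literature.AlgebraicGeometry.CossartJannsenSaito2020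
open Literature.AlgebraicGeometry.Resolution.AffinePointBlowup (P ξ)
open Scheme.IdealSheafData

namespace Summit.ResolutionOfSingularities.ResolutionOfSingularities.Theorems.PIDim4

namespace E2OfCJS

open RidgeBudget (ebar)
open SigmaMaxModificationsCorridor3.Moving.LocalChains (false_of_units_chain)

/-! ## §1 The interface: the local ring of `z³ + F` at the origin, and «presented by `F`» -/

/-- [OURS] **The local ring of the hypersurface `z³ + F = 0` at the origin of `𝔸⁵_L`**:
`𝒪_{𝔸⁵_L, 0} ⧸ (z³ + F)_0` — the stalk of the tree's ideal sheaf `hypSheaf 3 F` at the origin `ξ`. [folklore] -/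
def HypStalk (L : Type) [Field L] (F : MvPolynomial (Fin 4) L) : CommRingCat.{0} :=
  CommRingCat.of ((P 4 L).presheaf.stalk (ξ 4 L) ⧸ stalkIdeal (hypSheaf 3 F) (ξ 4 L))

/-- [OURS] **«`(S, s)` is presented by `F`»**: the local ring of `S` at `s` is (isomorphic to) the local ring of
`z³ + F = 0` at the origin over `L`. [folklore] -/
def PresentedBy (L : Type) [Field L] (F : MvPolynomial (Fin 4) L) (S : Scheme.{0}) (s : S) : Prop :=
  Nonempty (S.presheaf.stalk s ≅ HypStalk L F)

/-! ## §2 The five sub-rows (OURS, untagged parameterless `Prop`s; not asserted) -/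

/-- [OURS · row (N) NEAR · res-dim4-p-1 g2] Two points presented, over the same PERFECT field of characteristic
`3`, by residual polynomials of order EXACTLY `3` have the same Hilbert–Samuel function at every level: the
Hilbert–Samuel function of a multiplicity-`3` hypersurface point in a regular `5`-dimensional ambient is one
function (CJS Ch. 2; «near ⟺ the multiplicity is `3` again»).  NOT proved here. (OURS row — parameterless
`Prop`, deliberately untagged so that the gate does not relocate it; not asserted.) -/
def NearRow : Prop :=
  ∀ (L : Type) [Field L] [CharP L 3] [PerfectField L] (F G : MvPolynomial (Fin 4) L),
    ordZero F = (3 : ℕ∞) → ordZero G = (3 : ℕ∞) →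
    ∀ (X : Scheme.{0}) [IsLocallyNoetherian X] (x : X) (Y : Scheme.{0}) [IsLocallyNoetherian Y] (y : Y),
      PresentedBy L F X x → PresentedBy L G Y y → ∀ N : ℕ, Scheme.hsFun X N x = Scheme.hsFun Y N y

/-- [OURS · row (E) DIRECTRIX · res-dim4-p-1 g2 (identity offered by res-dim4-p-5 g2)] A point presented over a
PERFECT field of characteristic `3` by `F` of order EXACTLY `3` has `e = ē = ebar F` (the dimension of the
additive subspace `A(in₃ F)`): `Dir(z³ + Φ) ≅ A(Φ)` through `v ↦ ((−Φ(v))^{1/3}, v)`, `L`-linear on `A(Φ)` over a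
perfect `L` (CJS Def. 2.18 / 2.21 / 2.26; tree `PointBlowup.additiveSubspace`).  NOT proved here. (OURS row —
parameterless `Prop`, deliberately untagged; not asserted.) -/
def DirectrixRow : Prop :=
  ∀ (L : Type) [Field L] [CharP L 3] [PerfectField L] (F : MvPolynomial (Fin 4) L), ordZero F = (3 : ℕ∞) →
    ∀ (X : Scheme.{0}) [IsLocallyNoetherian X] (x : X), PresentedBy L F X x →
      Scheme.dirDim X x = ebar F ∧ Scheme.geomDirDim X x = ebar F

/-- [OURS · row (I) ISOLATION · res-dim4-p-2] A LOCAL scheme presented over a PERFECT field of characteristic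
`3` by `F` of order EXACTLY `3` with `IsIsolated 3 F` (no equimultiple curve through the origin: every minimal
prime of `J₃⁺(F)` through `0` is `𝔪₀`) has its closed point ISOLATED in its Hilbert–Samuel locus at every
level `N ≥ 5 = dim + 1` (the Hilbert–Samuel functions are upper semicontinuous along specialisations at levels
above the dimension; T-ISO-1: the `3`-fold locus of `z³ + F` — all `z`-Hasse derivatives of `z³` of order `< 3`
vanish in characteristic `3` — projects onto `V(J₃⁺(F))`).  NOT proved here. (OURS row — parameterless
`Prop`, deliberately untagged; not asserted.) -/
def IsolationRow : Prop :=
  ∀ (L : Type) [Field L] [CharP L 3] [PerfectField L] (F : MvPolynomial (Fin 4) L), ordZero F = (3 : ℕ∞) →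
    IsIsolated 3 F → ∀ (S : Scheme.{0}) [IsLocallyNoetherian S] (s : S), IsLocalAt S s → PresentedBy L F S s →
      ∀ N : ℕ, 5 ≤ N → IsIsolatedInHSMaxLocus S N s

/-- [OURS · row (X) SETTING · res-dim4-p-2] A LOCAL scheme presented over a PERFECT field of characteristic `3`
by `F` of order EXACTLY `3` is excellent (a localised finite-type algebra over a field), of dimension `≤ 5`
(in truth `= 4`: a hypersurface germ in `𝔸⁵`; the transfer row consumes only `≤ N = 5`), satisfies (F1)
(`CharHypothesis`: `dim + 2 ≤ 2·3`, cf. `charHypothesis_of_dim_four_char_three`), and its (reduced) closed point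
is a permissible centre.  NOT proved here. (OURS row — parameterless `Prop`, deliberately untagged; not
asserted.) -/
def SettingRow : Prop :=
  ∀ (L : Type) [Field L] [CharP L 3] [PerfectField L] (F : MvPolynomial (Fin 4) L), ordZero F = (3 : ℕ∞) →
    ∀ (S : Scheme.{0}) [IsLocallyNoetherian S] (s : S), IsLocalAt S s → PresentedBy L F S s →
      ∀ hcl : IsClosed ({s} : Set S),
        Scheme.IsExcellent S ∧ topologicalKrullDim ↥S ≤ (5 : WithBot ℕ∞) ∧ CharHypothesis S s ∧
          IdealSheafData.IsPermissible (vanishingIdeal (⟨{s}, hcl⟩ : Closeds S))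

/-- [OURS · row (M) MODEL · res-dim4-p-2 (typ-3's `PointStep*` INVARIANT is its chart side)] Over an
ALGEBRAICALLY CLOSED field `K` of characteristic `3`, every E2-violating frame chain `c` has a LOCAL
HYPERSURFACE MODEL: local schemes `S i` (local at `pt i`), point blow-ups `π i : B i ⟶ S i`, closed points `b i`
over `pt i`, links `IsLocalSchemeAt (S (i+1)) (pt (i+1)) (B i) (b i)`, with `(S i, pt i)` presented by the
frame's own `(c i).F` and `(B i, b i)` by `(c (i+1)).F` (`S 0 = Spec 𝒪_{X,0}` for `X : z³ + (c 0).F = 0` in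
`𝔸⁵_K`; blow-up commutes with localisation; the next closed `3`-fold point is RATIONAL (`K = K̄`), read in the
chart `x_j`, translated by `b`, cleaned by the `z`-translation `z ↦ z − Σ c_e^{1/3} x^e` — an automorphism of the
ambient fixing the point, so the local ring is that of `z³ + (c (i+1)).F` at the origin).  NOT proved here.
(OURS row — parameterless `Prop`, deliberately untagged; not asserted.) -/
def ModelRow : Prop :=
  ∀ (K : Type) [Field K] [CharP K 3] [IsAlgClosed K] [DecidableEq K] (c : ℕ → State K),
    (∀ k, IsIsolated 3 (c k).F ∧ Step0 3 (c k) (c (k + 1)) ∧ ordZero (c k).F = (3 : ℕ∞) ∧ ebar (c k).F = 2) →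
    ∃ (S B : ℕ → Scheme.{0}) (_ : ∀ i, IsLocallyNoetherian (S i)) (_ : ∀ i, IsLocallyNoetherian (B i))
      (π : ∀ i, B i ⟶ S i) (pt : ∀ i, ↥(S i)) (b : ∀ i, ↥(B i)) (hcl : ∀ i, IsClosed ({pt i} : Set (S i))),
      (∀ i, IsBlowup (π i) (vanishingIdeal ⟨{pt i}, hcl i⟩)) ∧ (∀ i, (π i).base (b i) = pt i) ∧
      (∀ i, IsClosed ({b i} : Set (B i))) ∧ (∀ i, IsLocalSchemeAt (S (i + 1)) (pt (i + 1)) (B i) (b i)) ∧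
      (∀ i, IsLocalAt (S i) (pt i)) ∧
      (∀ i, PresentedBy K (c i).F (S i) (pt i)) ∧ (∀ i, PresentedBy K (c (i + 1)).F (B i) (b i))

/-- [OURS] **The transfer row over ALGEBRAICALLY CLOSED fields** — `IsolatedConeTwoChainLocalizes` (p663256)
with the extra binder `[IsAlgClosed K]`; what the five sub-rows compose to, and all the endgame needs
(`IsolatedChainBaseChange.noIsolatedTrap_of_forall_isAlgClosed`).  (OURS row — parameterless `Prop`,
deliberately untagged; not asserted.) -/
def IsolatedConeTwoChainLocalizesAlgClosed : Prop :=
  ∀ (K : Type) [Field K] [CharP K 3] [IsAlgClosed K] [DecidableEq K] (c : ℕ → State K),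
    (∀ k, IsIsolated 3 (c k).F ∧ Step0 3 (c k) (c (k + 1)) ∧ ordZero (c k).F = (3 : ℕ∞) ∧ ebar (c k).F = 2) →
    ∃ (N : ℕ) (S B : ℕ → Scheme.{0}) (hS : ∀ i, IsLocallyNoetherian (S i)) (hB : ∀ i, IsLocallyNoetherian (B i))
      (π : ∀ i, B i ⟶ S i) (pt : ∀ i, ↥(S i)) (b : ∀ i, ↥(B i)) (hcl : ∀ i, IsClosed ({pt i} : Set (S i))),
      (∀ i, IsBlowup (π i) (vanishingIdeal ⟨{pt i}, hcl i⟩)) ∧ (∀ i, (π i).base (b i) = pt i) ∧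
      (∀ i, IsClosed ({b i} : Set (B i))) ∧
      (∀ i, Scheme.hsFun (B i) N (b i) = Scheme.hsFun (S i) N (pt i)) ∧
      (∀ i, IsLocalSchemeAt (S (i + 1)) (pt (i + 1)) (B i) (b i)) ∧ IsLocalAt (S 0) (pt 0) ∧
      Scheme.IsExcellent (S 0) ∧ topologicalKrullDim ↥(S 0) ≤ (N : WithBot ℕ∞) ∧ CharHypothesis (S 0) (pt 0) ∧
      (∀ i, IdealSheafData.IsPermissible (vanishingIdeal (⟨{pt i}, hcl i⟩ : Closeds (S i)))) ∧
      (∀ i, @Scheme.dirDim (S i) (hS i) (pt i) = 2) ∧ (∀ i, @Scheme.geomDirDim (S i) (hS i) (pt i) = 2) ∧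
      (∀ i, @Scheme.dirDim (B i) (hB i) (b i) = 2) ∧ (∀ i, @Scheme.geomDirDim (B i) (hB i) (b i) = 2) ∧
      (∀ i, @IsIsolatedInHSMaxLocus (S i) (hS i) N (pt i))

/-- The all-fields transfer row (p663256) implies its algebraically-closed restriction. [OURS · glue] [folklore] -/
theorem isolatedConeTwoChainLocalizesAlgClosed_of_all (h : IsolatedConeTwoChainLocalizes) :
    IsolatedConeTwoChainLocalizesAlgClosed :=
  fun K _ _ _ _ c hc => h K c hc

/-! ## §3 The composition (bookkeeping only) and the per-field endgame -/

/-- **The five sub-rows compose to the transfer row over algebraically closed fields.**  Given the model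
(M) of an E2-violating chain over `K = K̄`: (N) at `(B i, b i)` (presented by `(c (i+1)).F`) and `(S i, pt i)`
(presented by `(c i).F`) gives «near»; (E) gives `e = ē = ebar = 2` at every `pt i` and `b i`; (I) gives
isolation of every `pt i`; (X) at `S 0` gives excellence, `dim S 0 ≤ 5`, (F1), and at every `S i` the
permissibility of the point centre; the level is `N = 5 = dim + 1`. [OURS · glue] [folklore] -/
theorem isolatedConeTwoChainLocalizesAlgClosed_of_rows (hM : ModelRow) (hN : NearRow) (hE : DirectrixRow)
    (hI : IsolationRow) (hX : SettingRow) : IsolatedConeTwoChainLocalizesAlgClosed := by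
  intro K _ _ _ _ c hc
  obtain ⟨S, B, hS, hB, π, pt, b, hcl, hπ, hb, hbcl, hS', hloc, hpS, hpB⟩ := hM K c hc
  refine ⟨5, S, B, hS, hB, π, pt, b, hcl, hπ, hb, hbcl, ?_, hS', hloc 0, ?_, ?_, ?_, ?_, ?_, ?_, ?_, ?_, ?_⟩
  · intro i
    exact hN K (c (i + 1)).F (c i).F (hc (i + 1)).2.2.1 (hc i).2.2.1 (B i) (b i) (S i) (pt i) (hpB i) (hpS i) 5
  · exact (hX K (c 0).F (hc 0).2.2.1 (S 0) (pt 0) (hloc 0) (hpS 0) (hcl 0)).1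
  · exact (hX K (c 0).F (hc 0).2.2.1 (S 0) (pt 0) (hloc 0) (hpS 0) (hcl 0)).2.1
  · exact (hX K (c 0).F (hc 0).2.2.1 (S 0) (pt 0) (hloc 0) (hpS 0) (hcl 0)).2.2.1
  · intro i
    exact (hX K (c i).F (hc i).2.2.1 (S i) (pt i) (hloc i) (hpS i) (hcl i)).2.2.2
  · intro i
    rw [(hE K (c i).F (hc i).2.2.1 (S i) (pt i) (hpS i)).1, (hc i).2.2.2]
  · intro i
    rw [(hE K (c i).F (hc i).2.2.1 (S i) (pt i) (hpS i)).2, (hc i).2.2.2]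
  · intro i
    rw [(hE K (c (i + 1)).F (hc (i + 1)).2.2.1 (B i) (b i) (hpB i)).1, (hc (i + 1)).2.2.2]
  · intro i
    rw [(hE K (c (i + 1)).F (hc (i + 1)).2.2.1 (B i) (b i) (hpB i)).2, (hc (i + 1)).2.2.2]
  · intro i
    exact hI K (c i).F (hc i).2.2.1 (hc i).1 (S i) (pt i) (hloc i) (hpS i) 5 le_rfl

/-- **No `e = ē = 2` cone chain over an algebraically closed field, from CJS Thm. 6.40 and the
algebraically-closed transfer row** (`LocalChains.false_of_units_chain`, field by field). [OURS · conditional]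
[cite: CossartJannsenSaito2020, Thm. 6.40] -/
theorem no_coneTwo_chain_of_CJS_algClosed (hK640 : KeyTheorem640_char_localized_isolated.{0})
    (hT : IsolatedConeTwoChainLocalizesAlgClosed) (K : Type) [Field K] [CharP K 3] [IsAlgClosed K]
    [DecidableEq K] :
    ¬ ∃ c : ℕ → State K, ∀ k, IsIsolated 3 (c k).F ∧ Step0 3 (c k) (c (k + 1)) ∧
      ordZero (c k).F = (3 : ℕ∞) ∧ ebar (c k).F = 2 := by
  rintro ⟨c, hc⟩
  obtain ⟨N, S, B, hS, hB, π, pt, b, hcl, hπ, hb, hbcl, hH, hS', hloc, hexc, hdim, hchar, hperm, he, hē, heB,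
    hēB, hiso⟩ := hT K c hc
  exact @false_of_units_chain hK640 N S B hS hB π pt b hcl hπ hb hbcl hH hS' hloc hexc hdim hchar hperm he hē
    heB hēB hiso

/-- **The per-field endgame**: over ONE field `K` of characteristic `3`, if there is no infinite isolated
`Step0 3` chain on the `e = ē = 2` cone, there is no infinite isolated `Step0 3` chain at all — the tree's
order dichotomy (`IsolatedBand.isolated_chain_order_dichotomy_three`), K2(3) (`FreeTailProof.noIsolatedBandRun3`),
the stabilisation `ē ∈ {1, 2}` on the cone (`Directrix.isolated_cone_chain_eventually_one_or_two`) and FT(3,3)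
(`IsolatedBand.no_isolated_cone_chain_one_of_freeTail` with `FreeTailProof.noIsolatedFreeTailAt_self`), read for
one field (their global forms are p660329 / p661515). [OURS · glue] [folklore] -/
theorem no_isolated_chain_of_no_coneTwo_chain (K : Type) [Field K] [CharP K 3] [DecidableEq K]
    (hE2 : ¬ ∃ c : ℕ → State K, ∀ k, IsIsolated 3 (c k).F ∧ Step0 3 (c k) (c (k + 1)) ∧
      ordZero (c k).F = (3 : ℕ∞) ∧ ebar (c k).F = 2) :
    ¬ ∃ c : ℕ → State K, ∀ k, IsIsolated 3 (c k).F ∧ Step0 3 (c k) (c (k + 1)) := by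
  rintro ⟨c, hc⟩
  haveI : Fact (Nat.Prime 3) := ⟨Nat.prime_three⟩
  rcases IsolatedBand.isolated_chain_order_dichotomy_three hc with hall | ⟨k₀, htail⟩
  · exact FreeTailProof.noIsolatedBandRun3 K
      ⟨fun k => c (k + 1), fun k => ⟨(hc (k + 1)).1, (hc (k + 1)).2, hall (k + 1) (by omega)⟩⟩
  · have hc' : ∀ k, IsIsolated 3 (c (k₀ + k)).F ∧ Step0 3 (c (k₀ + k)) (c (k₀ + k + 1)) ∧
        ordZero (c (k₀ + k)).F = (3 : ℕ∞) := fun k =>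
      ⟨(hc (k₀ + k)).1, (hc (k₀ + k)).2, htail (k₀ + k) (Nat.le_add_right _ _)⟩
    obtain ⟨N, e, hN1, he12, hN⟩ := Directrix.isolated_cone_chain_eventually_one_or_two (c := fun k => c (k₀ + k)) hc'
    rcases he12 with rfl | rfl
    · exact IsolatedBand.no_isolated_cone_chain_one_of_freeTail 3 (FreeTailProof.noIsolatedFreeTailAt_self 3)
        (c := fun k => c (k₀ + k)) (fun k => ⟨(hc' k).1, (hc' k).2.1⟩) hN1 (by exact_mod_cast (hc' N).2.2) hN
    · exact hE2 ⟨fun k => c (k₀ + (N + k)), fun k => ⟨(hc' (N + k)).1, by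
        simpa [Nat.add_assoc] using (hc' (N + k)).2.1, (hc' (N + k)).2.2, hN (N + k) (Nat.le_add_right N k)⟩⟩

/-- **F4-I(3,3) FROM CJS Thm. 6.40 MODULO THE ALGEBRAICALLY-CLOSED TRANSFER ROW**: it suffices to exclude
isolated chains over algebraically closed fields (p-14's `IsolatedChainBaseChange.noIsolatedTrap_of_forall_isAlgClosed`),
where the row + Thm. 6.40 exclude the cone chains and the per-field endgame does the rest.
[OURS · conditional assembly] [cite: CossartJannsenSaito2020, Thm. 6.40] -/
theorem noIsolatedTrap_three_three_of_CJS_algClosed (hK640 : KeyTheorem640_char_localized_isolated.{0})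
    (hT : IsolatedConeTwoChainLocalizesAlgClosed) : NoIsolatedTrap 3 3 :=
  IsolatedChainBaseChange.noIsolatedTrap_of_forall_isAlgClosed 3 3 fun K _ _ _ _ =>
    no_isolated_chain_of_no_coneTwo_chain K (no_coneTwo_chain_of_CJS_algClosed hK640 hT K)

/-- **F4-I(3,3) from CJS Thm. 6.40 and the five sub-rows.** [OURS · conditional assembly]
[cite: CossartJannsenSaito2020, Thm. 6.40] -/
theorem noIsolatedTrap_three_three_of_CJS_rows (hK640 : KeyTheorem640_char_localized_isolated.{0})
    (hM : ModelRow) (hN : NearRow) (hE : DirectrixRow) (hI : IsolationRow) (hX : SettingRow) :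
    NoIsolatedTrap 3 3 :=
  noIsolatedTrap_three_three_of_CJS_algClosed hK640 (isolatedConeTwoChainLocalizesAlgClosed_of_rows hM hN hE hI hX)

end E2OfCJS

end Summit.ResolutionOfSingularities.ResolutionOfSingularities.Theorems.PIDim4

end
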